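import Literature.Analysis.FluidPDE.Tao2016AveragedNS.SplitCascadeReducedPointwise
import Literature.Analysis.FluidPDE.Tao2016AveragedNS.SplitCascadeProfileRepro
import HarnessLib

/-!
# The split Prop. 6.5, pointwise: the full conclusion `RescaledSplitConclusion` for one datum

T. Tao, *Finite time blowup for an averaged three-dimensional Navier–Stokes equation*,
arXiv:1402.0290v3, §6.4 Prop. 6.5, §6.5 Prop. 6.12.
HONEST FRAMING: statements about the SPLIT cascade model system; nothing here proves the split
Prop. 6.5 and nothing here concerns the true Navier–Stokes equations.

`reducedConclusion_of_profile` (`SplitCascadeReducedPointwise.lean`) + the tree's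
`RescaledConclusion.of_reduced` + `profile_repro` (`SplitCascadeProfileRepro.lean`): for one datum of
the split Prop. 6.5 (hypotheses with error constant `C₁/2`, explicit scalar regime conditions, the
profile at the checkpoint, and a new profile `η', β' ≥ 0` dominating twice the reproduced levels)
there are `τ₁, μ₁` with `RescaledSplitConclusion γ ε₀ K ε n₀ η' β' Y W F τ₁ μ₁`, `γ = 10⁻⁵e^{-K¹⁰/2}`
(`splitConclusion_of_profile`). The remaining assembly of `rescaledSplitStepWith γ η β` is `InRegime`
bookkeeping: discharging the scalar conditions for `K`, `1/ε`, `n₀` large.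

## References

* T. Tao, arXiv:1402.0290v3, §6.4 Prop. 6.5, §6.5 Prop. 6.12. [`Tao2016AveragedNS`]
-/

noncomputable section

open Set MeasureTheory intervalIntegral

namespace Literature.Analysis.FluidPDE

namespace Tao2016AveragedNS

open TaoCascade hiding ExitTrichotomy
open TaoCascade.ZeroScale hiding Context Setting

section Pointwise

variable {ε₀ K ε C₁ C₂ C₃ : ℝ} {n₀ N : ℤ} {ηp : ℤ → ℝ} {βp : ℕ → ℝ} {τ : ℤ → ℝ}
  {Y : Fin 4 → ℤ → ℝ → ℝ} {W : Fin 3 → ℤ → ℝ → ℝ} {F : ℤ → ℝ → ℝ}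

/-- **The split Prop. 6.5, pointwise in the datum.** [cite: Tao2016AveragedNS, §6.4 Prop. 6.5] -/
theorem RescaledSplitHypotheses.splitConclusion_of_profile
    (h : RescaledSplitHypotheses (1 / 10 ^ 5 * Real.exp (-K ^ 10 / 2)) ε₀ K ε (C₁ / 2) C₂ C₃ n₀ N
      ηp βp τ Y W F)
    (hε₀ : 0 < ε₀) (hε₀1 : ε₀ < 1) (hε : 0 < ε) (hε1 : ε ≤ 1) (hC₁ : 0 ≤ C₁) (hC₂ : 0 ≤ C₂)
    (hC₃ : 0 ≤ C₃) (hN : n₀ ≤ N)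
    (hK18 : (10 : ℝ) ^ 18 ≤ K) (hKε : 10 ^ 8 ≤ ε₀ * K ^ 4) (hKε₀ : (10 : ℝ) ^ 6 ≤ K * ε₀)
    (hKD : 11 * K ^ (-(1 : ℝ) / 4) ≤ 1 / (2 * 10 ^ 5))
    (hκ : 36 * Real.sqrt 2 * K * ((K ^ 15)⁻¹ * (1 + ε₀) ^ (-(999 : ℝ) / 100) * C₃ *
      geomConst ε₀ ((248 : ℝ) / 100)) ≤ 1)
    (hKa : 24 * ((K ^ 30)⁻¹ * C₃ * geomConst ε₀ ((747 : ℝ) / 100)) ≤ K ^ (-(1 : ℝ) / 4))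
    (hKc : 48600 * K ^ 10 * Real.exp (-(188 / 100) * K ^ 10) * K ^ (-(1 : ℝ) / 4) *
      (C₃ * geomConst ε₀ ((741 : ℝ) / 100) + 1) ≤ 1)
    (hKd : K ^ (-(1 : ℝ) / 4) * (3 * C₃ * geomConst ε₀ ((245 : ℝ) / 100) + 1100) < 1 / 100)
    (hKe : Real.exp (3600 * Real.sqrt 2 * (K ^ 14)⁻¹) ≤ 2)
    (hKf1 : 100 * (54 * Real.sqrt 2) * K ^ (-(1 : ℝ) / 4) * Real.exp (-(94 / 100) * K ^ 10) ≤
      1 / 2 * (K ^ 15)⁻¹)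
    (hεexp : ε * Real.exp (10 ^ 6 * K ^ 10) ≤ 1)
    (hn : C₂ * (1 + ε₀) ^ (-(n₀ : ℝ) / 2) * cumEnergyConst ε₀ C₃ ≤ 1 / 100)
    (hδ1 : 4 * C₁ * (1 + ε₀) ^ (-(n₀ : ℝ) / 2) *
      (Real.exp 1 * (6 * Real.sqrt 2 * K) * cumEnergyConst ε₀ C₃ * C₃ * geomConst ε₀ ((496 : ℝ) / 100)) ≤
      ε ^ 2 * Real.exp (-K ^ 10) * K ^ (-(1 : ℝ) / 4))
    (hδ2 : 400 * C₁ * (1 + ε₀) ^ (-(n₀ : ℝ) / 2) ≤ ε ^ 2 * Real.exp (-K ^ 10) * K ^ (-(1 : ℝ) / 4))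
    (hδ3 : 400 * C₁ * (1 + ε₀) ^ (-(n₀ : ℝ) / 2) ≤ 1 / 2 * (K ^ 15)⁻¹)
    (hδ4 : Real.exp (6 / 100 * K ^ 10) * (4 * C₁ *
      (Real.exp 1 * (6 * Real.sqrt 2 * K) * cumEnergyConst ε₀ C₃ * C₃ * geomConst ε₀ ((496 : ℝ) / 100) +
        100)) * (1 + ε₀) ^ (-(n₀ : ℝ) / 2) ≤ 1 / 4 * (1 + ε₀) ^ (-(n₀ : ℝ) / 4))
    (hlate : (C₁ + C₂ + (C₂ * (1 + ε₀) ^ (2 : ℝ) * (cumEnergyConst ε₀ C₃ + 100) + C₁) + 1) *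
      (1 + ε₀) ^ (-(n₀ : ℝ) / 4) ≤ ε ^ 4 * Real.exp (-10 * K ^ 10))
    (hη0 : ηp 0 ≤ 1 / 10 ^ 3) {ηm : ℝ}
    (hη : ∀ i : Fin 3, |W i (-1) 0| ≤ ηm ∧ |W i 0 0| ≤ ηm ∧ |W i 1 0| ≤ ηm)
    (hζK : windowLevel ε₀ K ε (C₁ / 2) n₀ ηm ^ 2 ≤ 1 / 4 * (K ^ 20)⁻¹)
    (hsmall : 16 * (K ^ 5 * (1 + ε₀) ^ (2 : ℝ)) * ((ε ^ 2)⁻¹ + ε⁻¹ * K ^ 10 + K + 1) *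
      windowLevel ε₀ K ε (C₁ / 2) n₀ ηm ^ 2 ≤ C₁ / 2 * (1 + ε₀) ^ (-(n₀ : ℝ) / 2))
    (hδ5 : Real.exp (6 / 100 * K ^ 10) * (6 * ε ^ 2 * Real.exp (-K ^ 10) *
      ((Real.exp ((6 * (ε + ε ^ 2 + 2 * (ε ^ 2)⁻¹ + ε⁻¹ * K ^ 10) + 36 * K) * Real.sqrt 2 *
            ((K ^ 15)⁻¹ * C₃ * geomConst ε₀ ((248 : ℝ) / 100))) *
          ((4 * Real.sqrt 3 * (C₁ / 2) * (1 + ε₀) ^ (-(n₀ : ℝ) / 2)) *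
            ((K ^ 15)⁻¹ * C₃ * geomConst ε₀ ((248 : ℝ) / 100)))) ^ 2 *
          C₃ * geomConst ε₀ ((245 : ℝ) / 100) + 100 * windowLevel ε₀ K ε (C₁ / 2) n₀ ηm ^ 2)) ≤
      1 / 4 * (1 + ε₀) ^ (-(n₀ : ℝ) / 4))
    -- the new profile dominates twice the reproduced levels
    {η' : ℤ → ℝ} {β' : ℕ → ℝ} (hη'0 : ∀ m, 0 ≤ η' m) (hβ'0 : ∀ m, 0 ≤ β' m)
    (hη'prev : 2 * windowLevel ε₀ K ε (C₁ / 2) n₀ ηm ≤ η' (-1))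
    (hη'zero : 2 * windowLevel ε₀ K ε (C₁ / 2) n₀ ηm ≤ η' 0)
    (hη'hi : ∀ m : ℕ, 1 ≤ m →
      2 * (Real.exp ((ε + ε ^ 2 + 2 * (ε ^ 2)⁻¹ + ε⁻¹ * K ^ 10 + 6 * K) * Real.sqrt 2 * (K ^ 15)⁻¹ *
          (C₃ * geomConst ε₀ ((248 : ℝ) / 100) + 100)) *
        (Real.sqrt 3 * (C₁ / 2) * (1 + ε₀) ^ (-(n₀ : ℝ) / 2) * (K ^ 15)⁻¹ *
          (C₃ * geomConst ε₀ ((248 : ℝ) / 100) + 100))) ≤ η' m)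
    (hβ' : ∀ m : ℕ, 1 ≤ m → 2 * (Real.sqrt 2 * (K ^ 15)⁻¹ * (1 + ε₀) ^ (-(5 : ℝ) * m)) ≤ β' m) :
    ∃ τ₁ μ₁ : ℝ, RescaledSplitConclusion (1 / 10 ^ 5 * Real.exp (-K ^ 10 / 2)) ε₀ K ε n₀ η' β'
      Y W F τ₁ μ₁ := by
  have hK6 : (10 : ℝ) ^ 6 ≤ K := le_trans (by norm_num) hK18
  have hK2 : 2 ≤ K := le_trans (by norm_num) hK6
  have hK1 : 1 ≤ K := by linarith
  have hK0 : 0 < K := by linarith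
  have hC₁' : 0 ≤ C₁ / 2 := by linarith
  have hγ1 : 1 / 10 ^ 5 * Real.exp (-K ^ 10 / 2) ≤ 1 / 10 ^ 5 := by
    have : Real.exp (-K ^ 10 / 2) ≤ 1 := Real.exp_le_one_iff.mpr (by
      have : 0 ≤ K ^ 10 := by positivity
      linarith)
    have h5 : (0 : ℝ) ≤ 1 / 10 ^ 5 := by norm_num
    nlinarith
  -- Prop. 6.12♯ pointwise
  obtain ⟨τ₁, hτ₁, hred⟩ := h.reducedConclusion_of_profile hε₀ hε₀1 hε hε1 hC₁ hC₂ hC₃ hN hK18 hKε hKε₀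
    hKD hκ hKa hKc hKd hKe hKf1 hεexp hn hδ1 hδ2 hδ3 hδ4 hlate hη0 hη hζK hsmall hδ5
  -- the bootstrap time and the base conclusion
  have hBT : IsBootstrapTime ε₀ K Y F (T1 ε₀ K Y F) :=
    h.isBootstrapTime_T1_of_profile hε₀ hε₀1 hγ1 hK2 hKε hε hε1 hC₁' hC₂ hC₃ hN hn hη0 hη hζK
  have hbase := RescaledConclusion.of_reduced hε₀ hε₀1 hK0 hBT hred
  -- `μ₁ ≥ ½`
  have hμ : 1 / 2 ≤ Y 0 1 τ₁ := by
    have hq1 : (1 : ℝ) ≤ 1 + ε₀ := by linarith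
    have hlow : (1 + ε₀) ^ (-(1 : ℝ)) ≤ (1 + ε₀) ^ (-(1 : ℝ) / 100) :=
      Real.rpow_le_rpow_of_exponent_le hq1 (by norm_num)
    have hinv : (1 / 2 : ℝ) ≤ (1 + ε₀) ^ (-(1 : ℝ)) := by
      rw [Real.rpow_neg_one, le_inv_comm₀ (by norm_num) (by linarith)]; norm_num; linarith
    linarith only [hred.mu_ge, hlow, hinv]
  -- `2L ≤ a`, `a ≥ 0`, `μ₁ ≥ ½` ⇒ `L ≤ a μ₁`
  have key : ∀ {a L : ℝ}, 0 ≤ a → 2 * L ≤ a → L ≤ a * Y 0 1 τ₁ := by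
    intro a L ha hL
    have := mul_le_mul_of_nonneg_left hμ ha
    linarith only [this, hL]
  -- the profile at `τ₁`
  have hprof := h.profile_repro hε₀ hε₀1 hK1 hε hC₁' hC₃ hN hBT.le_hundred hBT.good hη hτ₁
    (η' := η') (β' := β') (μ₁ := Y 0 1 τ₁)
    (key (hη'0 (-1)) hη'prev) (key (hη'0 0) hη'zero)
    (fun m hm => key (hη'0 m) (hη'hi m hm)) (fun m hm => key (hβ'0 m) (hβ' m hm))
  exact ⟨τ₁, Y 0 1 τ₁, ⟨hbase, hprof.1, hprof.2.1, hprof.2.2⟩⟩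

end Pointwise

end Tao2016AveragedNS

end Literature.Analysis.FluidPDE
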